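import Literature.AlgebraicGeometry.Motives.HypersurfaceSplitLinearSections
import Literature.AlgebraicGeometry.Motives.LinearSubspacesGenerateChowProofs
import HarnessLib

/-!
# Linear subspaces of `X` in a common linear subspace of `X` are rationally equivalent in `CH_*(X)`

For an integral closed subvariety `j : X ↪ ℙᴺ_K` and a linear subspace `M = V₊(L₁, …, L_c)` contained
in `X` (an `(s+1)`-plane point `μ ∈ X`), every hyperplane section `Π = M ∩ V₊(ℓ)` (`V₊(ℓ) ⊅ X`) has
class `c₁(𝒪_X(1)) ∩ [M]` in `CH_s(X)` — the cycle `(j^*V₊(ℓ)) · [M]` is `[Π]` with multiplicity one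
(Fulton, *Intersection Theory*, Example 2.5.1 on `X`, via `Motives/ProjectiveSpaceHyperplaneMultiplicity`
and the closed immersion `j`), and `c₁(𝒪_X(1)) ∩ -` does not depend on the hyperplane (Cor. 2.4.2;
`ProjSpace.hyperplaneSectionOn_congr`, `Motives/ProjectiveSpaceHyperplaneSection`). Hence **two
`s`-planes of `X` lying in a common `(s+1)`-plane of `X` are rationally equivalent in `CH_s(X)`**:
two points of a line of `X` in `CH₀(X)`, two lines of a plane of `X` in `CH₁(X)`, two planes of a
`3`-plane of `X` in `CH₂(X)` — the elementary relations among the classes of linear subspaces of the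
cubic hypersurfaces of `Mboro2018_chowTwo_cubic` (`Motives/LinearSubspacesGenerateChow`; Mboro,
arXiv:1701.04488, Cor. 2.9 and p. 12, where all planes are shown equivalent for `dim X ≥ 9` via
`F₂(X)`).

* `ProjSpace.primeInter_pullbackAvoiding_formDivisor_eq_primeCycle` — `(j^*V₊(ℓ)) · [M] = [Π]` as
  cycles on `X`;
* `ProjSpace.mk_primeCycle_eq_hyperplaneSectionOn_of_section` — `[Π] = c₁(𝒪_X(1)) ∩ [M]`;
  `ProjSpace.ofPoint_eq_ofPoint_of_sections` — two sections: `[Π] = [Π']`;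
* `ProjSpace.exists_snoc_presentation_of_specializes` — an `s`-plane inside an `(s+1)`-plane is a
  hyperplane section of it (presentations by linear forms);
* `Hypersurface.notMem_span_singleton_of_two_le`,
  `Hypersurface.ofPoint_eq_ofPoint_of_isLinearSubspacePoint` — for a hypersurface of degree `≥ 2`
  (every hyperplane `⊅ X`): **`[Π] = [Π']` in `CH_s(X)` for `s`-planes `Π, Π' ⊆ M ⊆ X`**, stated with
  `IsLinearSubspacePoint` and specialisations `μ ⤳ z`, `μ ⤳ z'`.

Everything is proved; no definitions, no named facts.

## References

* W. Fulton, *Intersection Theory*, 2nd ed., Springer (1998): Example 2.5.1 (p. 41), Cor. 2.4.2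
  (p. 38), Prop. 2.3 (c) (p. 34). [Fulton1998]
* R. Hartshorne, *Algebraic Geometry*, GTM 52 (1977), I Ex. 2.11 (linear varieties). [Hartshorne1977]
* R. Mboro, *Remarks on the CH₂ of cubic hypersurfaces*, arXiv:1701.04488, Cor. 2.9 (p. 12). [Mboro2018]
-/

noncomputable section

universe u

open CategoryTheory AlgebraicGeometry Order Topology IsLocalRing
open Literature.AlgebraicGeometry.Motives.RatFn
open Literature.AlgebraicGeometry.Motives.Segre

attribute [local instance] MvPolynomial.gradedAlgebra

namespace Literature.AlgebraicGeometry.Motives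


namespace ProjSpace

variable {N : ℕ} {K : Type u} [Field K] {X : SchemeOver K} [IsIntegral X.left]
  [LocallyOfFiniteType X.hom] (j : X ⟶ projectiveSpace N K) [IsClosedImmersion j.left]

/-- **`(j^*V₊(ℓ)) · [M] = [Π]` as cycles on `X`** for a linear subspace `M = V₊(L₁, …, L_c)` of `X`
(given by a point `μ ∈ X` over its generic point) and its hyperplane section
`Π = V₊(L₁, …, L_c, ℓ)` (a point `z ∈ X`): the hyperplane `V₊(ℓ) ⊅ X` cuts the subvariety
`closure {μ}` of `X` in the single subvariety `closure {z}` with multiplicity one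
(`primeInter_formDivisor_last_eq_primeCycle` on `ℙᴺ`, transported along the closed immersion `j`,
on whose cycles `j_*` is injective). [cite: Fulton1998, Example 2.5.1 (p. 41) and Prop. 2.3 (c) (p. 34)] -/
theorem primeInter_pullbackAvoiding_formDivisor_eq_primeCycle {c : ℕ}
    (L : Fin c → MvPolynomial (Fin (N + 1)) K) (hL : ∀ k, L k ∈ grading (Fin (N + 1)) K 1)
    (hc : c + 1 ≤ N) {ℓ : MvPolynomial (Fin (N + 1)) K} (hℓ : ℓ ∈ grading (Fin (N + 1)) K 1)
    (hind : LinearIndependent K (Fin.snoc L ℓ : Fin (c + 1) → MvPolynomial (Fin (N + 1)) K))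
    (hℓ0 : ℓ ≠ 0) (hav : (formDivisor ℓ hℓ hℓ0).Avoids (j.left.base (genericPoint ↥X.left)))
    {μ z : ↥X.left}
    (hμ : (ProjectiveSpectrum.asHomogeneousIdeal
      (𝒜 := MvPolynomial.homogeneousSubmodule (Fin (N + 1)) K) (j.left.base μ)).toIdeal =
        Ideal.span (Set.range L))
    (hz : (ProjectiveSpectrum.asHomogeneousIdeal
      (𝒜 := MvPolynomial.homogeneousSubmodule (Fin (N + 1)) K) (j.left.base z)).toIdeal =
        Ideal.span (Set.range (Fin.snoc L ℓ : Fin (c + 1) → MvPolynomial (Fin (N + 1)) K))) :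
    ((formDivisor ℓ hℓ hℓ0).pullbackAvoiding j.left hav).primeInter μ = primeCycle z := by
  have hgr : ∀ k, (Fin.snoc (α := fun _ => MvPolynomial (Fin (N + 1)) K) L ℓ k) ∈ grading (Fin (N + 1)) K 1 := by
    intro k
    refine Fin.lastCases ?_ (fun i => ?_) k
    · rw [Fin.snoc_last]; exact hℓ
    · rw [Fin.snoc_castSucc]; exact hL i
  have hhom : ∀ k, (Fin.snoc (α := fun _ => MvPolynomial (Fin (N + 1)) K) L ℓ k).IsHomogeneous 1 :=
    fun k => (MvPolynomial.mem_homogeneousSubmodule 1 _).1 (hgr k)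
  -- `ℓ ∉ 𝔭(j μ) = (L)`
  have hℓμ : (formDivisor ℓ hℓ hℓ0).Avoids (j.left.base μ) := by
    refine (formDivisor_avoids_iff hℓ hℓ0 zero_lt_one).2 fun h => ?_
    have h' : ℓ ∈ Ideal.span (Set.range (fun k : Fin c =>
        Fin.snoc (α := fun _ => MvPolynomial (Fin (N + 1)) K) L ℓ k.castSucc)) := by
      simp only [Fin.snoc_castSucc]
      rw [← hμ]
      exact h
    have key := last_notMem_idealSpan_of_linearIndependent (Fin.snoc L ℓ) hhom hind
    rw [Fin.snoc_last] at key
    exact key h'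
  have hμ₀ : (ProjectiveSpectrum.asHomogeneousIdeal
      (𝒜 := MvPolynomial.homogeneousSubmodule (Fin (N + 1)) K) (j.left.base μ)).toIdeal =
        Ideal.span (Set.range (fun k : Fin c =>
          Fin.snoc (α := fun _ => MvPolynomial (Fin (N + 1)) K) L ℓ k.castSucc)) := by
    simp only [Fin.snoc_castSucc]
    exact hμ
  -- on `ℙᴺ`: `V₊(ℓ) · [j μ] = [j z]`
  have hP := primeInter_formDivisor_last_eq_primeCycle (N := N) (Fin.snoc L ℓ) hgr hind hc hμ₀ hz
  have hD : formDivisor (Fin.snoc (α := fun _ => MvPolynomial (Fin (N + 1)) K) L ℓ (Fin.last c)) (hgr _)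
      (hind.ne_zero _) = formDivisor ℓ hℓ hℓ0 :=
    formDivisor_congr (Fin.snoc_last (α := fun _ => MvPolynomial (Fin (N + 1)) K) ℓ L) _ _ _ _ rfl
  rw [hD] at hP
  -- transport along `j`
  refine algebraicCycleMap_injective_of_isClosedImmersion j.left ?_
  exact (CartierDivisor.map_primeInter_pullbackAvoiding j (isEffective_formDivisor hℓ hℓ0) hav hℓμ).trans
    (hP.trans (algebraicCycleMap_primeCycle j.left z).symm)

variable [Infinite K] {ℓ₀ : MvPolynomial (Fin (N + 1)) K} (hℓ₀ : ℓ₀ ∈ grading (Fin (N + 1)) K 1)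
  (hℓ₀0 : ℓ₀ ≠ 0) (hX₀ : (formDivisor ℓ₀ hℓ₀ hℓ₀0).Avoids (j.left.base (genericPoint ↥X.left)))

/-- **`[Π] = c₁(𝒪_X(1)) ∩ [M]` in `CH_s(X)` for a hyperplane section `Π` of a linear subspace `M` of
`X`** (an `(s+1)`-plane `M = V₊(L)` of `X ⊆ ℙᴺ` and `Π = M ∩ V₊(ℓ)`, `V₊(ℓ) ⊅ X`; Fulton,
Example 2.5.1 on `X`). [cite: Fulton1998, Example 2.5.1 (p. 41) and §2.5] -/
theorem mk_primeCycle_eq_hyperplaneSectionOn_of_section {c : ℕ}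
    (L : Fin c → MvPolynomial (Fin (N + 1)) K) (hL : ∀ k, L k ∈ grading (Fin (N + 1)) K 1)
    (hc : c + 1 ≤ N) {ℓ : MvPolynomial (Fin (N + 1)) K} (hℓ : ℓ ∈ grading (Fin (N + 1)) K 1)
    (hind : LinearIndependent K (Fin.snoc L ℓ : Fin (c + 1) → MvPolynomial (Fin (N + 1)) K))
    (hℓ0 : ℓ ≠ 0) (hav : (formDivisor ℓ hℓ hℓ0).Avoids (j.left.base (genericPoint ↥X.left)))
    {μ z : ↥X.left} {s : ℕ} (hμs : height μ = (s + 1 : ℕ)) (hzs : height z = s)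
    (hμ : (ProjectiveSpectrum.asHomogeneousIdeal
      (𝒜 := MvPolynomial.homogeneousSubmodule (Fin (N + 1)) K) (j.left.base μ)).toIdeal =
        Ideal.span (Set.range L))
    (hz : (ProjectiveSpectrum.asHomogeneousIdeal
      (𝒜 := MvPolynomial.homogeneousSubmodule (Fin (N + 1)) K) (j.left.base z)).toIdeal =
        Ideal.span (Set.range (Fin.snoc L ℓ : Fin (c + 1) → MvPolynomial (Fin (N + 1)) K))) :
    ChowGroup.ofPoint z hzs =
      hyperplaneSectionOn j hℓ₀ hℓ₀0 hX₀ s (ChowGroup.ofPoint μ hμs) := by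
  have hcyc := primeInter_pullbackAvoiding_formDivisor_eq_primeCycle j L hL hc hℓ hind hℓ0 hav hμ hz
  have h1 := mk_interCycle_pullbackAvoiding_eq_hyperplaneSectionOn j hℓ₀ hℓ₀0 hX₀ hℓ hℓ0 hav s
    (t := primeCycle μ) (primeCycle_mem_cyclesOfDim hμs)
  refine Eq.trans ?_ h1
  unfold ChowGroup.ofPoint
  congr 1
  apply Subtype.ext
  change primeCycle z = ((formDivisor ℓ hℓ hℓ0).pullbackAvoiding j.left hav).interCycle (primeCycle μ)
  rw [CartierDivisor.interCycle_primeCycle, hcyc]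

/-- **Two hyperplane sections of a linear subspace of `X` are rationally equivalent in `CH_s(X)`**:
if `Π = M ∩ V₊(ℓ)` and `Π' = M ∩ V₊(ℓ')` are hyperplane sections (`V₊(ℓ), V₊(ℓ') ⊅ X`) of an
`(s+1)`-plane `M ⊆ X`, then `[Π] = [Π']` in `CH_s(X)` — e.g. two points of a line of `X` in `CH₀(X)`,
two lines of a plane of `X` in `CH₁(X)`, two planes of a `3`-plane of `X` in `CH₂(X)` (both classes
are `c₁(𝒪_X(1)) ∩ [M]`, Fulton Example 2.5.1 with Cor. 2.4.2). [cite: Fulton1998, Example 2.5.1 (p. 41) and Cor. 2.4.2 (p. 38)] -/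
theorem ofPoint_eq_ofPoint_of_sections {c : ℕ}
    (L : Fin c → MvPolynomial (Fin (N + 1)) K) (hL : ∀ k, L k ∈ grading (Fin (N + 1)) K 1)
    (hc : c + 1 ≤ N) {ℓ ℓ' : MvPolynomial (Fin (N + 1)) K} (hℓ : ℓ ∈ grading (Fin (N + 1)) K 1)
    (hℓ' : ℓ' ∈ grading (Fin (N + 1)) K 1)
    (hind : LinearIndependent K (Fin.snoc L ℓ : Fin (c + 1) → MvPolynomial (Fin (N + 1)) K))
    (hind' : LinearIndependent K (Fin.snoc L ℓ' : Fin (c + 1) → MvPolynomial (Fin (N + 1)) K))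
    (hℓ0 : ℓ ≠ 0) (hℓ'0 : ℓ' ≠ 0)
    (hav : (formDivisor ℓ hℓ hℓ0).Avoids (j.left.base (genericPoint ↥X.left)))
    (hav' : (formDivisor ℓ' hℓ' hℓ'0).Avoids (j.left.base (genericPoint ↥X.left)))
    {μ z z' : ↥X.left} {s : ℕ} (hμs : height μ = (s + 1 : ℕ)) (hzs : height z = s)
    (hz's : height z' = s)
    (hμ : (ProjectiveSpectrum.asHomogeneousIdeal
      (𝒜 := MvPolynomial.homogeneousSubmodule (Fin (N + 1)) K) (j.left.base μ)).toIdeal =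
        Ideal.span (Set.range L))
    (hz : (ProjectiveSpectrum.asHomogeneousIdeal
      (𝒜 := MvPolynomial.homogeneousSubmodule (Fin (N + 1)) K) (j.left.base z)).toIdeal =
        Ideal.span (Set.range (Fin.snoc L ℓ : Fin (c + 1) → MvPolynomial (Fin (N + 1)) K)))
    (hz' : (ProjectiveSpectrum.asHomogeneousIdeal
      (𝒜 := MvPolynomial.homogeneousSubmodule (Fin (N + 1)) K) (j.left.base z')).toIdeal =
        Ideal.span (Set.range (Fin.snoc L ℓ' : Fin (c + 1) → MvPolynomial (Fin (N + 1)) K))) :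
    ChowGroup.ofPoint z hzs = ChowGroup.ofPoint z' hz's := by
  obtain ⟨l, hl⟩ := exists_formDivisor_avoids_genericPoint j
  rw [mk_primeCycle_eq_hyperplaneSectionOn_of_section j (X_mem K l) (MvPolynomial.X_ne_zero l) hl L hL hc hℓ
      hind hℓ0 hav hμs hzs hμ hz,
    mk_primeCycle_eq_hyperplaneSectionOn_of_section j (X_mem K l) (MvPolynomial.X_ne_zero l) hl L hL hc hℓ'
      hind' hℓ'0 hav' hμs hz's hμ hz']

end ProjSpace

namespace ProjSpace

variable {N : ℕ} {K : Type u} [Field K]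

/-- **An `s`-plane inside an `(s+1)`-plane is a hyperplane section of it**: given a presentation
`𝔭_w = (L₁, …, L_c)` of an `(s+1)`-plane point `w` of `ℙᴺ` by independent linear forms and an
`s`-plane point `w'` with `w ⤳ w'`, there is a linear form `ℓ` with `(L, ℓ)` independent and
`𝔭_{w'} = (L₁, …, L_c, ℓ)` (linear algebra: some equation of `w'` is not in the span of the `L_k`).
[cite: Hartshorne1977, I Ex. 2.11] -/
theorem exists_snoc_presentation_of_specializes {c s : ℕ} {w w' : ↥(projectiveSpace N K).left}
    (L : Fin c → MvPolynomial (Fin (N + 1)) K) (hL : LinearIndependent K L)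
    (hhom : ∀ k, (L k).IsHomogeneous 1)
    (hw : (ProjectiveSpectrum.asHomogeneousIdeal
      (𝒜 := MvPolynomial.homogeneousSubmodule (Fin (N + 1)) K) w).toIdeal = Ideal.span (Set.range L))
    (hws : height w = (s + 1 : ℕ)) (hw' : IsLinearSubspacePoint s N (𝟙 (projectiveSpace N K)) w')
    (hww' : w ⤳ w') (hc : c + 1 ≤ N) :
    ∃ ℓ : MvPolynomial (Fin (N + 1)) K, ℓ.IsHomogeneous 1 ∧
      LinearIndependent K (Fin.snoc L ℓ : Fin (c + 1) → MvPolynomial (Fin (N + 1)) K) ∧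
      (ProjectiveSpectrum.asHomogeneousIdeal
        (𝒜 := MvPolynomial.homogeneousSubmodule (Fin (N + 1)) K) w').toIdeal =
          Ideal.span (Set.range (Fin.snoc L ℓ : Fin (c + 1) → MvPolynomial (Fin (N + 1)) K)) := by
  obtain ⟨L', hL', hhom', -, hspan', hsN⟩ := hw'.exists_eq_span_of_id
  -- the dimension count: `c = N - (s + 1)`
  have hpl : IsLinearSubspacePoint (N - c) N (𝟙 (projectiveSpace N K)) w :=
    isLinearSubspacePoint_of_toIdeal_eq_span L hL hhom (by omega) hw
  have hcN : N - c = s + 1 := by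
    have h1 := hpl.1
    rw [hws] at h1
    exact_mod_cast h1.symm
  -- some `L' j` is not in the `K`-span of the `L k`
  have hex : ∃ j, L' j ∉ Submodule.span K (Set.range L) := by
    by_contra hall
    push Not at hall
    have hle : Submodule.span K (Set.range L') ≤ Submodule.span K (Set.range L) :=
      Submodule.span_le.2 (by rintro _ ⟨j, rfl⟩; exact hall j)
    haveI : FiniteDimensional K (Submodule.span K (Set.range L)) :=
      FiniteDimensional.span_of_finite K (Set.finite_range L)
    have h1 : Module.finrank K (Submodule.span K (Set.range L')) = N - s := by
      rw [finrank_span_eq_card hL', Fintype.card_fin]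
    have h2 : Module.finrank K (Submodule.span K (Set.range L)) = c := by
      rw [finrank_span_eq_card hL, Fintype.card_fin]
    have h3 := Submodule.finrank_mono hle
    rw [h1, h2] at h3
    omega
  obtain ⟨j, hj⟩ := hex
  refine ⟨L' j, hhom' j, linearIndependent_finSnoc.2 ⟨hL, hj⟩, ?_⟩
  have hind : LinearIndependent K (Fin.snoc L (L' j) : Fin (c + 1) → MvPolynomial (Fin (N + 1)) K) :=
    linearIndependent_finSnoc.2 ⟨hL, hj⟩
  have hgr : ∀ k, (Fin.snoc (α := fun _ => MvPolynomial (Fin (N + 1)) K) L (L' j) k).IsHomogeneous 1 := by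
    intro k
    refine Fin.lastCases ?_ (fun i => ?_) k
    · rw [Fin.snoc_last]; exact hhom' j
    · rw [Fin.snoc_castSucc]; exact hhom i
  obtain ⟨p, hp, hhtp, -⟩ := exists_point_of_linearIndependent (Fin.snoc L (L' j)) hind hgr hc
  -- `p ⤳ w'` with equal heights, hence `p = w'`
  have hpw' : p ⤳ w' := by
    refine specializes_iff_le.2 ?_
    rw [hp, hspan', Ideal.span_le]
    rintro _ ⟨k, rfl⟩
    refine Fin.lastCases ?_ (fun i => ?_) k
    · rw [Fin.snoc_last]
      exact Ideal.subset_span ⟨j, rfl⟩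
    · rw [Fin.snoc_castSucc]
      have hk : L i ∈ (ProjectiveSpectrum.asHomogeneousIdeal
          (𝒜 := MvPolynomial.homogeneousSubmodule (Fin (N + 1)) K) w).toIdeal := by
        rw [hw]; exact Ideal.subset_span ⟨i, rfl⟩
      have hk' := (specializes_iff_le.1 hww') hk
      change L i ∈ (ProjectiveSpectrum.asHomogeneousIdeal
        (𝒜 := MvPolynomial.homogeneousSubmodule (Fin (N + 1)) K) w').toIdeal at hk'
      rw [hspan'] at hk'
      exact hk'
  have hheight : height w' = height p := by
    rw [hw'.1, hhtp]
    norm_cast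
    omega
  have hfin : height p < ⊤ := by
    rw [hhtp]
    exact WithTop.coe_lt_top _
  rw [← eq_of_specializes_of_height_eq hpw' hheight hfin]
  exact hp

end ProjSpace

namespace Hypersurface

variable {K : Type u} [Field K] [Infinite K] {d e : ℕ} {X : SchemeOver K} [IsIntegral X.left]
  [LocallyOfFiniteType X.hom] (i : X ⟶ projectiveSpace (d + 1) K) [IsClosedImmersion i.left]
  {F : MvPolynomial (Fin (d + 1 + 1)) K} (hF : F ∈ grading (Fin (d + 1 + 1)) K e) (hprime : Prime F)
  (hrange : Set.range i.left.base =
    ProjectiveSpectrum.zeroLocus (MvPolynomial.homogeneousSubmodule (Fin (d + 1 + 1)) K) {F})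

open ProjSpace

include hF hprime in
omit [Infinite K] in
/-- A prime form of degree `≥ 2` is not a multiple of a nonzero linear form. [folklore] -/
theorem notMem_span_singleton_of_two_le (he : 2 ≤ e) {ℓ : MvPolynomial (Fin (d + 1 + 1)) K}
    (hℓ : ℓ ∈ grading (Fin (d + 1 + 1)) K 1) (hℓ0 : ℓ ≠ 0) : F ∉ Ideal.span {ℓ} := by
  intro hmem
  have hℓ1 : ℓ.totalDegree = 1 := ((MvPolynomial.mem_homogeneousSubmodule 1 ℓ).1 hℓ).totalDegree hℓ0
  have hFe : F.totalDegree = e := ((MvPolynomial.mem_homogeneousSubmodule e F).1 hF).totalDegree hprime.ne_zero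
  obtain ⟨G, hG⟩ := Ideal.mem_span_singleton.1 hmem
  -- `F = ℓ G` with `F` prime: `F ∣ ℓ` or `F ∣ G`
  rcases hprime.2.2 ℓ G ⟨1, by rw [mul_one]; exact hG.symm⟩ with h | h
  · have hle := MvPolynomial.totalDegree_le_of_dvd_of_isDomain h hℓ0
    omega
  · obtain ⟨H, rfl⟩ := h
    have h1 : F * (1 - ℓ * H) = 0 := by
      rw [mul_sub, mul_one, sub_eq_zero]
      conv_lhs => rw [hG]
      ring
    rcases mul_eq_zero.1 h1 with h2 | h2
    · exact hprime.ne_zero h2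
    · have hu : IsUnit ℓ := IsUnit.of_mul_eq_one H (sub_eq_zero.1 h2).symm
      have h0 := (MvPolynomial.isUnit_iff_totalDegree_of_isReduced.1 hu).2
      omega

include hF hprime hrange in
/-- **Linear subspaces of a hypersurface lying in a common linear subspace of it, one dimension up,
are rationally equivalent in `CH_*(X)`**: for a hypersurface `i : X ≅ V₊(F) ⊆ ℙ^{d+1}` of degree
`e ≥ 2` (`F` prime), an `(s+1)`-plane `M` of `X` and two `s`-planes `Π, Π' ⊆ M` of `X` (points
`μ ⤳ z`, `μ ⤳ z'` of `X`), `[Π] = [Π']` in `CH_s(X)` — e.g. two points of a line of `X` in `CH₀(X)`,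
two lines of a plane of `X` in `CH₁(X)`, two planes of a `3`-plane of `X` in `CH₂(X)`
(`ProjSpace.ofPoint_eq_ofPoint_of_sections`: both are hyperplane sections of `M`, of class
`c₁(𝒪_X(1)) ∩ [M]`; Fulton, Example 2.5.1 with Cor. 2.4.2). [cite: Fulton1998, Example 2.5.1 (p. 41) and Cor. 2.4.2 (p. 38)] -/
theorem ofPoint_eq_ofPoint_of_isLinearSubspacePoint (he : 2 ≤ e) {s : ℕ} {μ z z' : ↥X.left}
    (hμ : IsLinearSubspacePoint (s + 1) (d + 1) i μ) (hz : IsLinearSubspacePoint s (d + 1) i z)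
    (hz' : IsLinearSubspacePoint s (d + 1) i z') (hμz : μ ⤳ z) (hμz' : μ ⤳ z') :
    ChowGroup.ofPoint z hz.height_eq = ChowGroup.ofPoint z' hz'.height_eq := by
  -- presentations `𝔭(iμ) = (L)`, `𝔭(iz) = (L, ℓ)`, `𝔭(iz') = (L, ℓ')`
  have hμ' := hμ.base_of_isClosedImmersion
  obtain ⟨L, hL, hhom, -, hspan, hsN⟩ := hμ'.exists_eq_span_of_id
  have hc : d + 1 - (s + 1) + 1 ≤ d + 1 := by omega
  have hLg : ∀ k, L k ∈ grading (Fin (d + 1 + 1)) K 1 :=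
    fun k => (MvPolynomial.mem_homogeneousSubmodule 1 _).2 (hhom k)
  obtain ⟨ℓ, hℓh, hind, hzspan⟩ := exists_snoc_presentation_of_specializes L hL hhom hspan hμ'.1
    hz.base_of_isClosedImmersion (i.left.base.hom.map_specializes hμz) hc
  obtain ⟨ℓ', hℓ'h, hind', hz'span⟩ := exists_snoc_presentation_of_specializes L hL hhom hspan hμ'.1
    hz'.base_of_isClosedImmersion (i.left.base.hom.map_specializes hμz') hc
  have hℓ : ℓ ∈ grading (Fin (d + 1 + 1)) K 1 := (MvPolynomial.mem_homogeneousSubmodule 1 _).2 hℓh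
  have hℓ' : ℓ' ∈ grading (Fin (d + 1 + 1)) K 1 := (MvPolynomial.mem_homogeneousSubmodule 1 _).2 hℓ'h
  have hℓ0 : ℓ ≠ 0 := hind.ne_zero (Fin.last _) ∘ fun h => by rw [Fin.snoc_last]; exact h
  have hℓ'0 : ℓ' ≠ 0 := hind'.ne_zero (Fin.last _) ∘ fun h => by rw [Fin.snoc_last]; exact h
  exact ofPoint_eq_ofPoint_of_sections i L hLg hc hℓ hℓ' hind hind' hℓ0 hℓ'0
    (formDivisor_avoids_base_genericPoint i hF hprime hrange hℓ hℓ0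
      (notMem_span_singleton_of_two_le hF hprime he hℓ hℓ0))
    (formDivisor_avoids_base_genericPoint i hF hprime hrange hℓ' hℓ'0
      (notMem_span_singleton_of_two_le hF hprime he hℓ' hℓ'0))
    hμ.height_eq hz.height_eq hz'.height_eq hspan hzspan hz'span

end Hypersurface

end Literature.AlgebraicGeometry.Motives

end
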